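import Summits.KontsevichZagierPeriods.KontsevichZagierPeriods.Theorems.SoloInformedEquidimRelations
import HarnessLib
import HarnessLib.Audit

/-!
# SoloInformed — the equidimensional move sets are closed under products (Newton–Leibniz elimination, file 1b-A)

Solo programme `solo-KontsevichZagierPeriods-informed`, session s245 (K-NF file 1b-A of the
kernel programme of THEOREM NF, `paper/nl-elimination.md` §7).

`Literature/NumberTheory/Transcendental/KZProductIdeal.lean` proves that left products `[t] * ·`
send each of the four moves of the Kontsevich–Zagier calculus into `KZ.relations`
(`of_mul_mem_relations_of_mem_*`) and that the block flip `σ × τ ↔ τ × σ` is a move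
(`of_sub_of_reindex_mem_relations`), whence `relations` is a two-sided ideal of `FormalRep`.
For the equidimensional subgroup `relations₁₂ = closure ((1a) ∪ (1b) ∪ (2))` of file 583
(`soloInformedEquidimRelations`) one needs the same constructions with the MOVE SETS as targets,
which the Literature statements (conclusion `∈ relations`) do not expose.  This file records them:

* `soloInformed_of_mul_mem_domainAddRel`, `soloInformed_of_mul_mem_integrandAddRel`,
  `soloInformed_of_mul_mem_changeOfVariablesRel` — `[t] * (move) ∈ (the same move set)`;
* `soloInformed_of_sub_of_reindex_mem_changeOfVariablesRel` — relabelling coordinates is a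
  change-of-variables move (set level);
* **`soloInformed_mul_mem_equidimRelations_left/right`**, `soloInformed_mul_comm_mem_equidimRelations`
  — `relations₁₂` is a two-sided ideal of `FormalRep` and `*` is commutative modulo it.

The constructions are those of `KZProductIdeal.lean` (cylinder `τ × σ`, `vol (τ × N) = 0`,
`g ⊗ (f₁ + f₂)`, the block map `(y, x) ↦ (y, Φ x)` with `|det| = |det Φ'|`, the permutation
matrix of `e : Fin n ≃ Fin k`), re-run with the sharper targets; nothing new is claimed about them.

References: M. Kontsevich, D. Zagier, *Periods* (2001), §1.2 rules (1)–(2), §4.1;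
J. Bochnak, M. Coste, M.-F. Roy, *Real Algebraic Geometry* (1998), Prop. 2.2.6; this work
(THEOREM NF, `paper/nl-elimination.md`).
-/

noncomputable section

open scoped BigOperators

namespace Summit.KontsevichZagierPeriods.KontsevichZagierPeriods.Theorems

open Set MeasureTheory MvPolynomial
open Literature.ModelTheory.ExponentialFields
open Literature.NumberTheory.Transcendental Literature.NumberTheory.Transcendental.KZ
open Literature.NumberTheory.Transcendental.KZ.IntegralRep

variable {l n m k : ℕ}

/-! ### The three equidimensional move sets under left products `[t] * ·` -/

/-- **`[t] * (domain additivity)` is a domain-additivity move** (set level):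
`τ × (σ₁ ∪ σ₂) = (τ × σ₁) ∪ (τ × σ₂)`, `vol ((τ × σ₁) ∩ (τ × σ₂)) = vol τ · vol (σ₁ ∩ σ₂) = 0`,
`g ⊗ f = g ⊗ fᵢ` on `τ × σᵢ`.  The construction of
`KZ.of_mul_mem_relations_of_mem_domainAddRel`, with the move set as target.
[Kontsevich–Zagier 2001, §1.2 rule (1), §4.1] -/
theorem soloInformed_of_mul_mem_domainAddRel (t : IntegralRep l) {c : FormalRep}
    (hc : c ∈ domainAddRel) : of t * c ∈ domainAddRel := by
  obtain ⟨n, r, r₁, r₂, hdom, hnull, h₁, h₂, rfl⟩ := hc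
  rw [mul_sub, mul_sub, of_mul_of, of_mul_of, of_mul_of]
  refine ⟨l + n, t.prod r, t.prod r₁, t.prod r₂, ?_, ?_, ?_, ?_, rfl⟩
  · ext z
    simp only [prod_domain, mem_prodDomain, hdom, mem_union]
    tauto
  · have hsub : (t.prod r₁).domain ∩ (t.prod r₂).domain =
        {z : Fin (l + n) → ℝ | (fun i => z (Fin.castAdd n i)) ∈ t.domain ∧
          (fun j => z (Fin.natAdd l j)) ∈ r₁.domain ∩ r₂.domain} := by
      ext z
      simp only [prod_domain, mem_inter_iff, mem_prodDomain, mem_setOf_eq]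
      tauto
    rw [hsub, volume_cylinder, hnull, mul_zero]
  · intro z hz
    rw [prod_integrand_eq, prod_integrand_eq, prodFun_apply, prodFun_apply, h₁ hz.2]
  · intro z hz
    rw [prod_integrand_eq, prod_integrand_eq, prodFun_apply, prodFun_apply, h₂ hz.2]

/-- **`[t] * (integrand additivity)` is an integrand-additivity move** (set level):
`g ⊗ (f₁ + f₂) = g ⊗ f₁ + g ⊗ f₂` on `τ × σ`.  The construction of
`KZ.of_mul_mem_relations_of_mem_integrandAddRel`, with the move set as target.
[Kontsevich–Zagier 2001, §1.2 rule (1), §4.1] -/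
theorem soloInformed_of_mul_mem_integrandAddRel (t : IntegralRep l) {c : FormalRep}
    (hc : c ∈ integrandAddRel) : of t * c ∈ integrandAddRel := by
  obtain ⟨n, r, r₁, r₂, h₁, h₂, hadd, rfl⟩ := hc
  rw [mul_sub, mul_sub, of_mul_of, of_mul_of, of_mul_of]
  refine ⟨l + n, t.prod r, t.prod r₁, t.prod r₂, ?_, ?_, ?_, rfl⟩
  · ext z
    simp only [prod_domain, mem_prodDomain, h₁]
  · ext z
    simp only [prod_domain, mem_prodDomain, h₂]
  · intro z hz
    rw [prod_integrand_eq, prod_integrand_eq, prod_integrand_eq, Pi.add_apply, prodFun_apply,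
      prodFun_apply, prodFun_apply, hadd hz.2, Pi.add_apply, mul_add]

/-- **`[t] * (change of variables)` is a change-of-variables move** (set level): for `Φ` on `σ`
as in rule (2), the block map `Ψ (y, x) = (y, Φ x)` on `τ × σ` is `ℚ`-semialgebraic
(`isSemialgebraicMapOn_blockMap`), injective, has derivative `id × Φ' x` within `τ × σ`, image
`τ × Φ '' σ`, and `|det (id × Φ' x)| = |det Φ' x|`.  The construction of
`KZ.of_mul_mem_relations_of_mem_changeOfVariablesRel`, with the move set as target.
[Kontsevich–Zagier 2001, §1.2 rule (2), §4.1] -/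
theorem soloInformed_of_mul_mem_changeOfVariablesRel (t : IntegralRep l) {c : FormalRep}
    (hc : c ∈ changeOfVariablesRel) : of t * c ∈ changeOfVariablesRel := by
  obtain ⟨n, r, r', Φ, Φ', hΦ, hΦ', hinj, hdom, hf, rfl⟩ := hc
  rw [mul_sub, of_mul_of, of_mul_of]
  -- the linear identification `ℝˡ × ℝⁿ ≃ ℝˡ⁺ⁿ`
  let e : ((Fin l → ℝ) × (Fin n → ℝ)) ≃ₗ[ℝ] (Fin (l + n) → ℝ) :=
    { toFun := fun p => Fin.append p.1 p.2
      invFun := fun z => (fun i => z (Fin.castAdd n i), fun j => z (Fin.natAdd l j))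
      map_add' := fun p q => by
        ext i; refine Fin.addCases (fun i => ?_) (fun j => ?_) i <;> simp
      map_smul' := fun c p => by
        ext i; refine Fin.addCases (fun i => ?_) (fun j => ?_) i <;> simp
      left_inv := fun p => by ext <;> simp
      right_inv := fun z => by
        ext i; refine Fin.addCases (fun i => ?_) (fun j => ?_) i <;> simp }
  let eL : ((Fin l → ℝ) × (Fin n → ℝ)) ≃L[ℝ] (Fin (l + n) → ℝ) := e.toContinuousLinearEquiv
  have heL : ∀ p, eL p = Fin.append p.1 p.2 := fun p => rfl
  have heL_symm : ∀ z, eL.symm z = (fun i => z (Fin.castAdd n i), fun j => z (Fin.natAdd l j)) :=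
    fun z => rfl
  -- the block map and its derivative
  let Ψ : (Fin (l + n) → ℝ) → (Fin (l + n) → ℝ) := eL ∘ Prod.map id Φ ∘ eL.symm
  let Ψ' : (Fin (l + n) → ℝ) → (Fin (l + n) → ℝ) →L[ℝ] (Fin (l + n) → ℝ) := fun z =>
    (eL : _ →L[ℝ] _).comp ((((ContinuousLinearMap.id ℝ (Fin l → ℝ)).prodMap
      (Φ' (fun j => z (Fin.natAdd l j)))).comp (eL.symm : _ →L[ℝ] _)))
  have hΨ : ∀ z, Ψ z = Fin.append (fun i => z (Fin.castAdd n i)) (Φ fun j => z (Fin.natAdd l j)) :=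
    fun z => rfl
  have hdet : ∀ z, (Ψ' z).det = (Φ' (fun j => z (Fin.natAdd l j))).det := by
    intro z
    have hcoe : ((Ψ' z : (Fin (l + n) → ℝ) →L[ℝ] (Fin (l + n) → ℝ)) :
        (Fin (l + n) → ℝ) →ₗ[ℝ] (Fin (l + n) → ℝ)) =
      (e : ((Fin l → ℝ) × (Fin n → ℝ)) →ₗ[ℝ] (Fin (l + n) → ℝ)) ∘ₗ
        (((LinearMap.id : (Fin l → ℝ) →ₗ[ℝ] (Fin l → ℝ)).prodMap
          ((Φ' (fun j => z (Fin.natAdd l j)) : (Fin n → ℝ) →L[ℝ] (Fin n → ℝ)) :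
            (Fin n → ℝ) →ₗ[ℝ] (Fin n → ℝ))) ∘ₗ
        (e.symm : (Fin (l + n) → ℝ) →ₗ[ℝ] ((Fin l → ℝ) × (Fin n → ℝ)))) :=
      LinearMap.ext fun v => rfl
    change LinearMap.det _ = LinearMap.det _
    rw [hcoe, LinearMap.det_conj, LinearMap.det_prodMap, LinearMap.det_id, one_mul]
  have hS : (t.prod r).domain = eL.symm ⁻¹' (t.domain ×ˢ r.domain) := rfl
  refine ⟨l + n, t.prod r, t.prod r', Ψ, Ψ', ?_, ?_, ?_, ?_, ?_, rfl⟩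
  · exact (isSemialgebraicMapOn_blockMap t.isSemialgebraic_domain hΦ).congr fun z _ => (hΨ z).symm
  · intro z hz
    have hx : (fun j => z (Fin.natAdd l j)) ∈ r.domain := hz.2
    have hg : HasFDerivWithinAt (Prod.map id Φ)
        ((ContinuousLinearMap.id ℝ (Fin l → ℝ)).prodMap (Φ' (fun j => z (Fin.natAdd l j))))
        (t.domain ×ˢ r.domain) (eL.symm z) := by
      refine HasFDerivWithinAt.prodMap (eL.symm z) (hasFDerivWithinAt_id _ _) ((hΦ' _ hx).mono ?_)
      rintro _ ⟨q, hq, rfl⟩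
      exact hq.2
    have h2 := (eL.comp_hasFDerivWithinAt_iff).mpr hg
    have h3 := (eL.symm.comp_right_hasFDerivWithinAt_iff (f := eL ∘ Prod.map id Φ)).mpr h2
    rw [hS]
    exact h3
  · intro z₁ hz₁ z₂ hz₂ h
    rw [hΨ, hΨ] at h
    have h' := congrArg (fun w : Fin (l + n) → ℝ =>
      ((fun i => w (Fin.castAdd n i)), (fun j => w (Fin.natAdd l j)))) h
    simp only [Fin.append_left, Fin.append_right, Prod.mk.injEq] at h'
    have h2 : (fun j => z₁ (Fin.natAdd l j)) = fun j => z₂ (Fin.natAdd l j) := hinj hz₁.2 hz₂.2 h'.2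
    rw [← Fin.append_castAdd_natAdd (f := z₁), ← Fin.append_castAdd_natAdd (f := z₂), h'.1, h2]
  · ext w
    simp only [prod_domain, mem_prodDomain, hdom, mem_image]
    constructor
    · rintro ⟨hw₁, x, hx, hwx⟩
      refine ⟨Fin.append (fun i => w (Fin.castAdd n i)) x,
        ⟨by simpa using hw₁, by simpa using hx⟩, ?_⟩
      rw [hΨ]
      simp only [Fin.append_left, Fin.append_right]
      conv_rhs => rw [← Fin.append_castAdd_natAdd (f := w)]
      simp [hwx]
    · rintro ⟨z, hz, rfl⟩
      rw [hΨ]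
      simp only [Fin.append_left, Fin.append_right]
      exact ⟨by simpa using hz.1, _, hz.2, rfl⟩
  · intro z hz
    rw [prod_integrand_eq, prod_integrand_eq, prodFun_apply, hf _ hz.2, hdet, hΨ, prodFun_append,
      mul_assoc]

/-! ### Reindexing coordinates is a change-of-variables move (set level) -/

/-- **`[r] − [r.reindex e] ∈ changeOfVariablesRel`**: `e : Fin n ≃ Fin k` forces `k = n`, and
`Φ z = z ∘ e⁻¹` is a coordinate permutation (linear, injective, polynomial over `ℚ`, `|det| = 1` by
`Matrix.abs_det_submatrix_equiv_equiv`).  The construction of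
`KZ.of_sub_of_reindex_mem_relations`, with the move set as target.
[Kontsevich–Zagier 2001, §1.2 rule (2)] -/
theorem soloInformed_of_sub_of_reindex_mem_changeOfVariablesRel (r : IntegralRep n)
    (e : Fin n ≃ Fin k) : of r - of (r.reindex e) ∈ changeOfVariablesRel := by
  obtain rfl : n = k := by simpa using Fintype.card_congr e
  -- the linear map `z ↦ z ∘ e.symm` as a matrix
  let M : Matrix (Fin n) (Fin n) ℝ := (1 : Matrix (Fin n) (Fin n) ℝ).submatrix e.symm (Equiv.refl _)
  let L : (Fin n → ℝ) →L[ℝ] (Fin n → ℝ) := LinearMap.toContinuousLinearMap (Matrix.toLin' M)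
  have hL : ∀ z : Fin n → ℝ, L z = fun j => z (e.symm j) := by
    intro z
    change Matrix.toLin' M z = _
    rw [Matrix.toLin'_apply, Matrix.submatrix_mulVec_equiv, Matrix.one_mulVec]
    rfl
  have hdet : |L.det| = 1 := by
    change |LinearMap.det (Matrix.toLin' M)| = 1
    rw [LinearMap.det_toLin', Matrix.abs_det_submatrix_equiv_equiv, Matrix.det_one, abs_one]
  refine ⟨n, r, r.reindex e, fun z => fun j => z (e.symm j), fun _ => L, ?_, ?_, ?_, ?_, ?_, rfl⟩
  · -- semialgebraic: a coordinate (polynomial) map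
    convert isSemialgebraicMapOn_aeval r.isSemialgebraic_domain
      (fun j => (X (e.symm j) : MvPolynomial (Fin n) ℚ)) using 2 with z
    ext j; simp
  · intro z _
    have h := L.hasFDerivWithinAt (s := r.domain) (x := z)
    convert h using 1
    ext z' j
    rw [hL]
  · intro z₁ _ z₂ _ h
    ext i
    have := congrFun h (e i)
    simpa using this
  · ext w
    simp only [IntegralRep.reindex_domain, mem_setOf_eq, mem_image]
    constructor
    · intro hw
      exact ⟨fun i => w (e i), hw, by ext j; simp⟩
    · rintro ⟨z, hz, rfl⟩
      simpa using hz
  · intro z _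
    rw [hdet, mul_one, IntegralRep.reindex_integrand]
    simp

/-! ### `relations₁₂` is a two-sided ideal; `*` is commutative modulo `relations₁₂` -/

/-- **Left products with a generator preserve `relations₁₂`**: `c ∈ relations₁₂ → [t] * c ∈ relations₁₂`
(closure induction; each equidimensional move goes to a move of the same kind).
[Kontsevich–Zagier 2001, §4.1; this work, THEOREM NF] -/
theorem soloInformed_of_mul_mem_equidimRelations (t : IntegralRep l) {c : FormalRep}
    (hc : c ∈ soloInformedEquidimRelations) : of t * c ∈ soloInformedEquidimRelations := by
  refine AddSubgroup.closure_induction (fun x hx => ?_) ?_ (fun x y _ _ hx hy => ?_)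
    (fun x _ hx => ?_) hc
  · rcases hx with (hx | hx) | hx
    · exact soloInformed_domainAddRel_subset_equidimRelations
        (soloInformed_of_mul_mem_domainAddRel t hx)
    · exact soloInformed_integrandAddRel_subset_equidimRelations
        (soloInformed_of_mul_mem_integrandAddRel t hx)
    · exact soloInformed_changeOfVariablesRel_subset_equidimRelations
        (soloInformed_of_mul_mem_changeOfVariablesRel t hx)
  · rw [mul_zero]; exact soloInformedEquidimRelations.zero_mem
  · rw [mul_add]; exact soloInformedEquidimRelations.add_mem hx hy
  · rw [mul_neg]; exact soloInformedEquidimRelations.neg_mem hx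

/-- **`relations₁₂` is a left ideal**: `c ∈ relations₁₂ → c' * c ∈ relations₁₂` (additivity in `c'`).
[Kontsevich–Zagier 2001, §4.1; this work, THEOREM NF] -/
theorem soloInformed_mul_mem_equidimRelations_left (c' : FormalRep) {c : FormalRep}
    (hc : c ∈ soloInformedEquidimRelations) : c' * c ∈ soloInformedEquidimRelations := by
  induction c' using FreeAbelianGroup.induction_on with
  | zero => rw [zero_mul]; exact soloInformedEquidimRelations.zero_mem
  | of x =>
    obtain ⟨l, t⟩ := x
    exact soloInformed_of_mul_mem_equidimRelations t hc
  | neg x ih => rw [neg_mul]; exact soloInformedEquidimRelations.neg_mem ih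
  | add x y hx hy => rw [add_mul]; exact soloInformedEquidimRelations.add_mem hx hy

/-- **`*` is commutative modulo `relations₁₂`, on generators**: `[r] * [s] − [s] * [r] ∈ relations₁₂`
(the block flip `finAddFlip` is a set-level change-of-variables move, via
`IntegralRep.prod_eq_reindex_prod`). [Kontsevich–Zagier 2001, §4.1] -/
theorem soloInformed_of_mul_of_sub_mem_equidimRelations (r : IntegralRep n) (s : IntegralRep m) :
    of r * of s - of s * of r ∈ soloInformedEquidimRelations := by
  rw [of_mul_of, of_mul_of, IntegralRep.prod_eq_reindex_prod r s, ← neg_sub]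
  exact soloInformedEquidimRelations.neg_mem
    (soloInformed_changeOfVariablesRel_subset_equidimRelations
      (soloInformed_of_sub_of_reindex_mem_changeOfVariablesRel _ _))

/-- **`*` is commutative modulo `relations₁₂`**: `c * d − d * c ∈ relations₁₂` for all formal
combinations (biadditivity from the generator case). [Kontsevich–Zagier 2001, §4.1] -/
theorem soloInformed_mul_comm_mem_equidimRelations (c d : FormalRep) :
    c * d - d * c ∈ soloInformedEquidimRelations := by
  induction c using FreeAbelianGroup.induction_on with
  | zero => simp [soloInformedEquidimRelations.zero_mem]
  | of x =>
    induction d using FreeAbelianGroup.induction_on with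
    | zero => simp [soloInformedEquidimRelations.zero_mem]
    | of y =>
      obtain ⟨n, r⟩ := x
      obtain ⟨m, s⟩ := y
      exact soloInformed_of_mul_of_sub_mem_equidimRelations r s
    | neg y ih =>
      have : FreeAbelianGroup.of x * -FreeAbelianGroup.of y -
            -FreeAbelianGroup.of y * FreeAbelianGroup.of x =
          -(FreeAbelianGroup.of x * FreeAbelianGroup.of y -
            FreeAbelianGroup.of y * FreeAbelianGroup.of x) := by
        rw [neg_mul, mul_neg]; abel
      rw [this]; exact soloInformedEquidimRelations.neg_mem ih
    | add y z hy hz =>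
      have : FreeAbelianGroup.of x * (y + z) - (y + z) * FreeAbelianGroup.of x =
          (FreeAbelianGroup.of x * y - y * FreeAbelianGroup.of x) +
            (FreeAbelianGroup.of x * z - z * FreeAbelianGroup.of x) := by
        rw [mul_add, add_mul]; abel
      rw [this]; exact soloInformedEquidimRelations.add_mem hy hz
  | neg x ih =>
    have : -FreeAbelianGroup.of x * d - d * -FreeAbelianGroup.of x =
        -(FreeAbelianGroup.of x * d - d * FreeAbelianGroup.of x) := by
      rw [neg_mul, mul_neg]; abel
    rw [this]; exact soloInformedEquidimRelations.neg_mem ih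
  | add x y hx hy =>
    have : (x + y) * d - d * (x + y) = (x * d - d * x) + (y * d - d * y) := by
      rw [add_mul, mul_add]; abel
    rw [this]; exact soloInformedEquidimRelations.add_mem hx hy

/-- **`relations₁₂` is a right ideal**: `c ∈ relations₁₂ → c * c' ∈ relations₁₂`
(`c * c' = (c * c' − c' * c) + c' * c`). [Kontsevich–Zagier 2001, §4.1; this work, THEOREM NF] -/
theorem soloInformed_mul_mem_equidimRelations_right (c' : FormalRep) {c : FormalRep}
    (hc : c ∈ soloInformedEquidimRelations) : c * c' ∈ soloInformedEquidimRelations := by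
  have := soloInformedEquidimRelations.add_mem (soloInformed_mul_comm_mem_equidimRelations c c')
    (soloInformed_mul_mem_equidimRelations_left c' hc)
  simpa using this

/-- **`relations₁₂` is a two-sided ideal**: congruent factors have congruent products,
`c₁ − c₂ ∈ relations₁₂ → d₁ − d₂ ∈ relations₁₂ → c₁ * d₁ − c₂ * d₂ ∈ relations₁₂`, i.e. `*`
descends to `P₁₂ = FormalRep ⧸ relations₁₂`. [this work, THEOREM NF (the graded ring `P₁₂`)] -/
theorem soloInformed_mul_sub_mul_mem_equidimRelations {c₁ c₂ d₁ d₂ : FormalRep}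
    (hc : c₁ - c₂ ∈ soloInformedEquidimRelations) (hd : d₁ - d₂ ∈ soloInformedEquidimRelations) :
    c₁ * d₁ - c₂ * d₂ ∈ soloInformedEquidimRelations := by
  have h1 : (c₁ - c₂) * d₁ ∈ soloInformedEquidimRelations :=
    soloInformed_mul_mem_equidimRelations_right d₁ hc
  have h2 : c₂ * (d₁ - d₂) ∈ soloInformedEquidimRelations :=
    soloInformed_mul_mem_equidimRelations_left c₂ hd
  have : c₁ * d₁ - c₂ * d₂ = (c₁ - c₂) * d₁ + c₂ * (d₁ - d₂) := by
    simp only [sub_mul, mul_sub]; abel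
  rw [this]
  exact soloInformedEquidimRelations.add_mem h1 h2

/-- The product representations of `relations₁₂`-congruent factors are `relations₁₂`-congruent:
`[r] − [r'] ∈ relations₁₂ → [s] − [s'] ∈ relations₁₂ → [r × s] − [r' × s'] ∈ relations₁₂`.
[this work, THEOREM NF] -/
theorem soloInformed_of_prod_sub_of_prod_mem_equidimRelations {n' m' : ℕ} {r : IntegralRep n}
    {r' : IntegralRep n'} {s : IntegralRep m} {s' : IntegralRep m'}
    (hr : of r - of r' ∈ soloInformedEquidimRelations)
    (hs : of s - of s' ∈ soloInformedEquidimRelations) :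
    of (r.prod s) - of (r'.prod s') ∈ soloInformedEquidimRelations := by
  have h := soloInformed_mul_sub_mul_mem_equidimRelations hr hs
  rwa [of_mul_of, of_mul_of] at h

end Summit.KontsevichZagierPeriods.KontsevichZagierPeriods.Theorems
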